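/-
Copyright (c) 2026 the pub-hodgecm-mathlib formalisation cell (harness21).  Prover seat hodgecm-mathlib-K2Liu-p01 (g2): Track B «K2-LIT»,
#184♮ = hLiu418 = stmt-HodgeConjecture-24832, STEWARD of socket #41 `sig_K2LiuSiegelEisensteinContinuation`; LEAD F0P6-plan (g10) DEAL
2026-09-03T23:22:15Z «O41.5 Gindikin–Karpelevich for the Siegel parabolic»; REPORT-FIRST O41.5 220813e546421255 §3 file (4).
-/
import Literature.NumberTheory.GelbartRogawski1991.LocalDoubledUnitaryIwahori          -- ★ `matA`, `matS`, `isSiegelDelta_iff_blkC_eq_zero`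
import Literature.NumberTheory.GelbartRogawski1991.LocalUnitaryFrameTransport          -- ★ `FrameTransport.frameConj` (`g' ↦ Q g' Q⁻¹`)
import Literature.NumberTheory.GelbartRogawski1991.LocalDoubledRationalFrameSiegel      -- ★ `coe_frameConj_apply_apply`
import Literature.NumberTheory.Automorphic.UnitaryGroupIwasawaFiniteAdelic             -- ★ `UnitaryGroup.exists_upper_mul_mem_localInt` (`U(J_N) = B·K`)
import Summits.HodgeConjecture.HodgeConjecture.Theorems.K2LiuLocalSiegelIwasawaFrame    -- file (4a): the rational frame `Q`, `blkC_frame_conj_eq_zero`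
import HarnessLib

/-!
# Crux `HLiu418`, road `K2_Liu`, socket #41, organ O41.5, file (4): THE LOCAL IWASAWA DECOMPOSITION
# `H(F_v) = P_Δ(F_v) · H(𝒪_v)` of the doubled unitary group at every good finite place

Cell `hodgecm-mathlib`, crux item hLiu418 = `stmt-HodgeConjecture-24832`; squad K2 ∕ K2Liu; prover K2Liu-p01 (g2), steward of #41.
THEOREMS ONLY (no `def`, no instance, no notation, no named-fact hypothesis, no `sorry`); lane `--supports stmt-HodgeConjecture-24832`.
THIS FILE (4b) = §4 the transport lemmas + §5 the decomposition; the frame algebra (§1–§3) is file (4a) ★ `K2LiuLocalSiegelIwasawaFrame`.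

THE STATEMENT (`exists_isSiegelDelta_mul_mem_localInt`).  `E/F` a quadratic extension of number fields with `c`, `δ` (`c δ = −δ ≠ 0`),
`v` a finite place of `F`, `𝕍 = (Eⁿ, T₀)` with `T₀ ∈ Sym_n(F)` invertible, `H(F_v) = U(T₀ ⊕ −T₀)(F_v)` the doubled group on the tree's
carrier ★ `UnitaryGroup.localPi E c (n+n) JD v`, `P_Δ(F_v)` its Siegel parabolic (★ local `IsSiegelDelta`), `K_v = H(𝒪_v)` (★ `localInt`).
IF `v` is GOOD — `|2|_w = 1` and `T₀`, `T₀⁻¹` integral at every `w ∣ v` (all but finitely many `v`, ★ `eventually_isGoodPlace`) — THEN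
**every `h ∈ H(F_v)` is `p · k` with `p ∈ P_Δ(F_v)` and `k ∈ K_v`.**

THE PROOF (transport of structure, no new analysis).  The RATIONAL FRAME `Q = e₂ ∘ (R · diag(1, ½T₀⁻¹W)) ∈ GL_{2n}(F)` (`R = (1 1; 1 −1)` the
tree's ★ `cayR`, `W` the antidiagonal permutation) satisfies `Qᵀ (T₀ ⊕ −T₀) Q = J_{2n}` (Mok's antidiagonal form, ★ `StdForm.antidiagonal`) and
carries the standard isotropic flag onto `Δ = {(x,x)}`; so ★ `FrameTransport.frameConj Q : U(J_{2n})(F_v) ≃ H(F_v)` maps the UPPER TRIANGULAR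
Borel of `U(J_{2n})` into `P_Δ` (§3: in the `Δ`-adapted frame the conjugate is block upper triangular, `C = 0`), and — `Q, Q⁻¹` being
`v`-integral at a good place — maps `U(J_{2n})(𝒪_v)` into `H(𝒪_v)` (§4).  The Iwasawa decomposition `U(J_{2n})(F_v) = B · U(J_{2n})(𝒪_v)` is ★
`UnitaryGroup.exists_upper_mul_mem_localInt` (every finite `v`, split or not).  [BruhatTits1972, (4.4.3)] [Tits1979, §3.3.2] [Casselman1980, §3].

CONSEQUENCES (§5).  With ★ D10 `K2Lit/LocalSiegelIntertwining` (`IsSphericalSection`): at a good place the spherical section of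
`I_v(s, χ_v)` is UNIQUE (`IsSphericalSection.unique` becomes unconditional) — the `φ°_s` of the Gindikin–Karpelevich identity O41.5 is pinned.
HONEST LABEL.  Count-neutral helper; it retires nothing by itself: `HC_CM` is proved only modulo the 7 printed citations (2 remaining named inputs:
hLiu418 = `stmt-HodgeConjecture-24832`, h413 = `stmt-HodgeConjecture-24833`) until rung 0 closes.

## References
* [BruhatTits1972] F. Bruhat, J. Tits, *Groupes réductifs sur un corps local I*, Publ. IHÉS 41 (1972): Prop. (4.4.3) (Iwasawa decomposition).
* [Tits1979] J. Tits, *Reductive groups over local fields*, Corvallis (1979): §3.3.2.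
* [Casselman1980] W. Casselman, Compositio Math. 40 (1980): §3 (spherical vectors via `G = PK`).
* [HarrisKudlaSweet1996] M. Harris, S. Kudla, W. J. Sweet, J. AMS 9 (1996): §1 (1.11) (the Siegel parabolic `P_Δ` of the doubled space).
* [Kudla1994] S. S. Kudla, Israel J. Math. 87 (1994): §3.
-/

set_option autoImplicit false
set_option linter.dupNamespace false -- the mandated namespace repeats `HodgeConjecture.HodgeConjecture`

noncomputable section

open NumberField IsDedekindDomain Matrix
open Literature.NumberTheory.Automorphic Literature.NumberTheory.Automorphic.UnitaryGroup
open Literature.NumberTheory.GelbartRogawski1991.AdaptedBlocks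
open Literature.NumberTheory.GelbartRogawski1991.UnitaryDualPair.LocalSplitting

namespace Summit.HodgeConjecture.HodgeConjecture.Cruxes.HLiu418.K2LiuLocalSiegelIwasawa

open Summit.HodgeConjecture.HodgeConjecture.Cruxes.HLiu418.K2LiuLocalSiegelIwasawaFrame

/-! ## §4 The transport: `frameConj Q` maps the Borel of `U(J_{2n})` into `P_Δ` and `U(J_{2n})(𝒪_v)` into `H(𝒪_v)` -/

section Transport

variable (F : Type) [Field F] [NumberField F] (E : Type) [Field E] [NumberField E] [Algebra F E]
  [Algebra.IsQuadraticExtension F E] (c : E ≃ₐ[F] E)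
  {δ : E} (hcδ : c δ = -δ) (hδ : δ ≠ 0) {d : F} (hd : δ * δ = algebraMap F E d)
  (v : HeightOneSpectrum (𝓞 F)) (n : ℕ) {T₀ : Matrix (Fin n) (Fin n) F} (hT₀ : T₀.IsSymm)
  {JD : Matrix (Fin (n + n)) (Fin (n + n)) E} (hJD : JD = (gramD F n T₀).map (algebraMap F E))

omit [NumberField F] [NumberField E] [Algebra.IsQuadraticExtension F E] in
/-- `J_{2n}` over `E` is `J_{2n}` over `F` base-changed (the frame transport's `hJ'`). [folklore] -/
theorem antidiagonal_over_eq_map :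
    (StdForm.antidiagonal (n + n)).over E = ((StdForm.antidiagonal (n + n)).over F).map (algebraMap F E) :=
  (StdForm.over_map _ _).symm

/-- `reindex e e` is multiplicative. [folklore] -/
theorem reindex_mul_reindex {R m k : Type*} [CommRing R] [Fintype m] [Fintype k] [DecidableEq m] [DecidableEq k] (e : m ≃ k)
    (M N : Matrix m m R) : Matrix.reindex e e M * Matrix.reindex e e N = Matrix.reindex e e (M * N) := by
  simp only [Matrix.reindex_apply, Matrix.submatrix_mul_equiv]

omit [Algebra.IsQuadraticExtension F E] in
/-- an element of `U(J_{2n})(F_v)` upper triangular at every `w ∣ v` has upper triangular matrix over `E ⊗ F_v = Π_{w ∣ v} E_w`, hence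
BLOCK upper triangular halves. [folklore] -/
theorem toBlocks₂₁_matS_eq_zero {N : ℕ} {J' : Matrix (Fin (N + N)) (Fin (N + N)) E} (b' : UnitaryGroup.localPi E c (N + N) J' v)
    (hb' : ∀ w : PlacesOver E v, (((b' : UnitaryGroup.LocalGLPi E (N + N) v) w : GL (Fin (N + N)) (w.1.adicCompletion E)) :
      Matrix (Fin (N + N)) (Fin (N + N)) (w.1.adicCompletion E)).BlockTriangular id) :
    (Matrix.reindex (e₂ N).symm (e₂ N).symm (matS F E c v N b')).toBlocks₂₁ = 0 := by
  refine toBlocks₂₁_reindex_eq_zero_of_blockTriangular ?_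
  intro i j hij
  funext w
  have h := hb' w hij
  rw [coe_component_eq_matS_map, Matrix.map_apply] at h
  exact h

include hcδ hδ hd hT₀ hJD in
/-- **The frame conjugation maps upper triangular elements of `U(J_{2n})(F_v)` into `P_Δ(F_v)`.**  For ANY rational frame `Q` whose
matrix is `e₂ ∘ (1 D; 1 −D)` (first `n` columns spanning `Δ`). [cite: HarrisKudlaSweet1996, §1 (1.11)] [cite: Casselman1980, §3] -/
theorem isSiegelDelta_frameConj (D : Matrix (Fin n) (Fin n) F) (Q : GL (Fin (n + n)) F)
    (hQm : (Q : Matrix (Fin (n + n)) (Fin (n + n)) F) = Matrix.reindex (e₂ n) (e₂ n) (Matrix.fromBlocks 1 D 1 (-D)))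
    (hQ : (Q : Matrix (Fin (n + n)) (Fin (n + n)) F)ᵀ * gramD F n T₀ * (Q : Matrix (Fin (n + n)) (Fin (n + n)) F) =
      (StdForm.antidiagonal (n + n)).over F)
    (b' : UnitaryGroup.localPi E c (n + n) ((StdForm.antidiagonal (n + n)).over E) v)
    (hb' : ∀ w : PlacesOver E v, (((b' : UnitaryGroup.LocalGLPi E (n + n) v) w : GL (Fin (n + n)) (w.1.adicCompletion E)) :
      Matrix (Fin (n + n)) (Fin (n + n)) (w.1.adicCompletion E)).BlockTriangular id) :
    IsSiegelDelta F E c hcδ hδ hd v n hT₀ hJD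
      (FrameTransport.frameConj F E c v (n + n) hJD (antidiagonal_over_eq_map F E n) Q hQ b') := by
  set φ : F →+* UnitaryGroup.LocalRing E v := (UnitaryGroup.toLocalRing E v).comp (algebraMap F (v.adicCompletion F)) with hφ
  -- the matrix of `Q b' Q⁻¹` over `E ⊗ F_v`
  have hGL : (UnitaryGroup.localPiEquiv E c (n + n) JD v
        (FrameTransport.frameConj F E c v (n + n) hJD (antidiagonal_over_eq_map F E n) Q hQ b')).1 =
      FrameTransport.framePloc F E v (n + n) Q * (UnitaryGroup.localPiEquiv E c (n + n) _ v b').1 *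
        (FrameTransport.framePloc F E v (n + n) Q)⁻¹ := by
    rw [FrameTransport.localPiEquiv_frameConj]
    exact FrameTransport.coe_frameConjLocal F E c v (n + n) hJD (antidiagonal_over_eq_map F E n) Q hQ _
  have hS : matS F E c v n (FrameTransport.frameConj F E c v (n + n) hJD (antidiagonal_over_eq_map F E n) Q hQ b') =
      (Q : Matrix (Fin (n + n)) (Fin (n + n)) F).map φ * matS F E c v n b' * ((Q⁻¹ : GL (Fin (n + n)) F) : Matrix (Fin (n + n)) (Fin (n + n)) F).map φ := by
    have h := congrArg Units.val hGL
    simp only [Units.val_mul] at h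
    rw [matS, h]
    rfl
  -- pass to the halves
  have hA : Matrix.reindex (e₂ n).symm (e₂ n).symm ((Q : Matrix (Fin (n + n)) (Fin (n + n)) F).map φ) =
      cayR (UnitaryGroup.LocalRing E v) (Fin n) * Matrix.fromBlocks 1 0 0 (D.map φ) := by
    rw [hQm, Matrix.reindex_apply, Matrix.reindex_apply, ← Matrix.submatrix_map, Matrix.submatrix_submatrix, Equiv.self_comp_symm,
      Matrix.submatrix_id_id, Matrix.fromBlocks_map, Matrix.map_one _ (map_zero φ) (map_one φ), Matrix.map_neg _ (map_neg φ), frame_eq_cayR_mul']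
  have hBA : Matrix.reindex (e₂ n).symm (e₂ n).symm (((Q⁻¹ : GL (Fin (n + n)) F) : Matrix (Fin (n + n)) (Fin (n + n)) F).map φ) *
      (cayR (UnitaryGroup.LocalRing E v) (Fin n) * Matrix.fromBlocks 1 0 0 (D.map φ)) = 1 := by
    rw [← hA, reindex_mul_reindex, ← Matrix.map_mul, ← Units.val_mul, inv_mul_cancel, Units.val_one, Matrix.map_one _ (map_zero φ) (map_one φ),
      Matrix.reindex_apply, Matrix.submatrix_one_equiv]
  rw [isSiegelDelta_iff_blkC_eq_zero F E c hcδ hδ hd v n hT₀ hJD, matA, hS, ← reindex_mul_reindex, ← reindex_mul_reindex, hA]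
  exact blkC_frame_conj_eq_zero (D.map φ) _ _ (toBlocks₂₁_matS_eq_zero F E c v b' hb') hBA

omit [Algebra.IsQuadraticExtension F E] in
/-- `(M · W)_{ab} = M_{a, rev b}` for the antidiagonal permutation `W = 1.submatrix id rev`. [folklore] -/
theorem mul_antidiag_apply {R : Type*} [CommRing R] {m : Type*} (M : Matrix m (Fin n) R) (a : m) (b : Fin n) :
    (M * (1 : Matrix (Fin n) (Fin n) R).submatrix id Fin.rev) a b = M a (Fin.rev b) := by
  rw [show (1 : Matrix (Fin n) (Fin n) R).submatrix id Fin.rev = (1 : Matrix (Fin n) (Fin n) R).submatrix ⇑(Equiv.refl (Fin n)) Fin.rev from rfl,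
    Matrix.mul_submatrix_one, Matrix.submatrix_apply]
  rfl

omit [Algebra.IsQuadraticExtension F E] in
/-- `(W · M)_{ab} = M_{rev a, b}`. [folklore] -/
theorem antidiag_mul_apply {R : Type*} [CommRing R] {m : Type*} (M : Matrix (Fin n) m R) (a : Fin n) (b : m) :
    ((1 : Matrix (Fin n) (Fin n) R).submatrix Fin.rev id * M) a b = M (Fin.rev a) b := by
  rw [show (1 : Matrix (Fin n) (Fin n) R).submatrix Fin.rev id = (1 : Matrix (Fin n) (Fin n) R).submatrix Fin.rev ⇑(Equiv.refl (Fin n)) from rfl,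
    Matrix.one_submatrix_mul, Matrix.submatrix_apply]
  rfl

omit [Algebra.IsQuadraticExtension F E] in
/-- **At a good place the frame is integral**: if `|2|_w = 1` and `T₀`, `T₀⁻¹` are integral at `w`, then `Q` and `Q⁻¹` (matrices
`e₂ ∘ (1 D; 1 −D)`, `e₂ ∘ (½ ½; G −G)`, `D = ½ T₀⁻¹ W`, `G = W T₀`) have integral entries at `w`, i.e. `Q ∈ GL_{2n}(𝒪_w)`.
[cite: PlatonovRapinchuk1994, §5.1] [cite: BruhatTits1972, (4.4.3)] -/
theorem frame_mem_glInt (Q : GL (Fin (n + n)) F)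
    (hQm : (Q : Matrix (Fin (n + n)) (Fin (n + n)) F) = Matrix.reindex (e₂ n) (e₂ n)
      (Matrix.fromBlocks 1 ((2 : F)⁻¹ • (T₀⁻¹ * (1 : Matrix (Fin n) (Fin n) F).submatrix id Fin.rev)) 1
        (-((2 : F)⁻¹ • (T₀⁻¹ * (1 : Matrix (Fin n) (Fin n) F).submatrix id Fin.rev)))))
    (hQi : ((Q⁻¹ : GL (Fin (n + n)) F) : Matrix (Fin (n + n)) (Fin (n + n)) F) = Matrix.reindex (e₂ n) (e₂ n)
      (Matrix.fromBlocks ((2 : F)⁻¹ • (1 : Matrix (Fin n) (Fin n) F)) ((2 : F)⁻¹ • 1)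
        ((1 : Matrix (Fin n) (Fin n) F).submatrix Fin.rev id * T₀) (-((1 : Matrix (Fin n) (Fin n) F).submatrix Fin.rev id * T₀))))
    (w : PlacesOver E v) (h2 : ValuativeRel.valuation (w.1.adicCompletion E) (2 : w.1.adicCompletion E) = 1)
    (hT : ∀ i j : Fin n, ValuativeRel.valuation (w.1.adicCompletion E) (algebraMap E (w.1.adicCompletion E) (algebraMap F E (T₀ i j))) ≤ 1)
    (hTinv : ∀ i j : Fin n, ValuativeRel.valuation (w.1.adicCompletion E) (algebraMap E (w.1.adicCompletion E) (algebraMap F E (T₀⁻¹ i j))) ≤ 1) :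
    Matrix.GeneralLinearGroup.map (algebraMap E (w.1.adicCompletion E)) (Matrix.GeneralLinearGroup.map (algebraMap F E) Q) ∈
      glInt (n + n) (w.1.adicCompletion E) := by
  set ψ : F →+* w.1.adicCompletion E := (algebraMap E (w.1.adicCompletion E)).comp (algebraMap F E) with hψ
  have hψT : ∀ i j, ValuativeRel.valuation (w.1.adicCompletion E) (ψ (T₀ i j)) ≤ 1 := fun i j => hT i j
  have hψTi : ∀ i j, ValuativeRel.valuation (w.1.adicCompletion E) (ψ (T₀⁻¹ i j)) ≤ 1 := fun i j => hTinv i j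
  have hψ2 : ValuativeRel.valuation (w.1.adicCompletion E) (ψ (2 : F)⁻¹) ≤ 1 := by
    rw [map_inv₀, map_ofNat, map_inv₀, h2, inv_one]
  -- entrywise integrality of the two block matrices
  have hval1 : ∀ i j : Fin n, ValuativeRel.valuation (w.1.adicCompletion E) (ψ ((1 : Matrix (Fin n) (Fin n) F) i j)) ≤ 1 := by
    intro i j
    rw [Matrix.one_apply]
    split_ifs
    · rw [map_one, map_one]
    · rw [map_zero, map_zero]; exact zero_le_one
  have hD : ∀ i j : Fin n, ValuativeRel.valuation (w.1.adicCompletion E)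
      (ψ (((2 : F)⁻¹ • (T₀⁻¹ * (1 : Matrix (Fin n) (Fin n) F).submatrix id Fin.rev)) i j)) ≤ 1 := by
    intro i j
    rw [Matrix.smul_apply, mul_antidiag_apply, smul_eq_mul, map_mul, map_mul]
    exact mul_le_one' hψ2 (hψTi i (Fin.rev j))
  have hG : ∀ i j : Fin n, ValuativeRel.valuation (w.1.adicCompletion E)
      (ψ ((((1 : Matrix (Fin n) (Fin n) F).submatrix Fin.rev id * T₀)) i j)) ≤ 1 := by
    intro i j
    rw [antidiag_mul_apply]
    exact hψT _ _
  have hH : ∀ i j : Fin n, ValuativeRel.valuation (w.1.adicCompletion E) (ψ (((2 : F)⁻¹ • (1 : Matrix (Fin n) (Fin n) F)) i j)) ≤ 1 := by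
    intro i j
    rw [Matrix.smul_apply, smul_eq_mul, map_mul, map_mul]
    exact mul_le_one' hψ2 (hval1 i j)
  have hneg : ∀ x : F, ValuativeRel.valuation (w.1.adicCompletion E) (ψ (-x)) = ValuativeRel.valuation (w.1.adicCompletion E) (ψ x) := by
    intro x; rw [map_neg, Valuation.map_neg]
  -- the `GL`-coercions
  have hcoe : ∀ (P : GL (Fin (n + n)) F),
      ((Matrix.GeneralLinearGroup.map (algebraMap E (w.1.adicCompletion E)) (Matrix.GeneralLinearGroup.map (algebraMap F E) P) :
          GL (Fin (n + n)) (w.1.adicCompletion E)) : Matrix (Fin (n + n)) (Fin (n + n)) (w.1.adicCompletion E)) =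
        (P : Matrix (Fin (n + n)) (Fin (n + n)) F).map ψ := by
    intro P
    change ((P : Matrix (Fin (n + n)) (Fin (n + n)) F).map (algebraMap F E)).map (algebraMap E (w.1.adicCompletion E)) = _
    rw [Matrix.map_map, hψ, RingHom.coe_comp]
  rw [mem_glInt_iff]
  refine ⟨fun i j => ?_, fun i j => ?_⟩
  · rw [Valuation.mem_integer_iff, hcoe, Matrix.map_apply, hQm, Matrix.reindex_apply, Matrix.submatrix_apply]
    rcases (e₂ n).symm i with a | b <;> rcases (e₂ n).symm j with a' | b'
    · rw [Matrix.fromBlocks_apply₁₁]; exact hval1 _ _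
    · rw [Matrix.fromBlocks_apply₁₂]; exact hD _ _
    · rw [Matrix.fromBlocks_apply₂₁]; exact hval1 _ _
    · rw [Matrix.fromBlocks_apply₂₂, Matrix.neg_apply, hneg]; exact hD _ _
  · rw [Valuation.mem_integer_iff, ← map_inv, ← map_inv, hcoe, Matrix.map_apply, hQi, Matrix.reindex_apply, Matrix.submatrix_apply]
    rcases (e₂ n).symm i with a | b <;> rcases (e₂ n).symm j with a' | b'
    · rw [Matrix.fromBlocks_apply₁₁]; exact hH _ _
    · rw [Matrix.fromBlocks_apply₁₂]; exact hH _ _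
    · rw [Matrix.fromBlocks_apply₂₁]; exact hG _ _
    · rw [Matrix.fromBlocks_apply₂₂, Matrix.neg_apply, hneg]; exact hG _ _

omit [Algebra.IsQuadraticExtension F E] in
/-- **The frame conjugation maps `U(J_{2n})(𝒪_v)` into `H(𝒪_v)`** when `Q_w, Q_w⁻¹ ∈ GL_{2n}(𝒪_w)` at every `w ∣ v`.
[cite: PlatonovRapinchuk1994, §5.1] -/
theorem frameConj_mem_localInt {T : Matrix (Fin (n + n)) (Fin (n + n)) F} {J : Matrix (Fin (n + n)) (Fin (n + n)) E}
    (hJ : J = T.map (algebraMap F E)) (Q : GL (Fin (n + n)) F)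
    (hQ : (Q : Matrix (Fin (n + n)) (Fin (n + n)) F)ᵀ * T * (Q : Matrix (Fin (n + n)) (Fin (n + n)) F) = (StdForm.antidiagonal (n + n)).over F)
    (hQw : ∀ w : PlacesOver E v, Matrix.GeneralLinearGroup.map (algebraMap E (w.1.adicCompletion E))
      (Matrix.GeneralLinearGroup.map (algebraMap F E) Q) ∈ glInt (n + n) (w.1.adicCompletion E))
    {k' : UnitaryGroup.localPi E c (n + n) ((StdForm.antidiagonal (n + n)).over E) v}
    (hk' : k' ∈ UnitaryGroup.localInt E c (n + n) ((StdForm.antidiagonal (n + n)).over E) v) :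
    FrameTransport.frameConj F E c v (n + n) hJ (antidiagonal_over_eq_map F E n) Q hQ k' ∈ UnitaryGroup.localInt E c (n + n) J v := by
  rw [UnitaryGroup.mem_localInt_iff] at hk' ⊢
  intro w
  rw [coe_frameConj_apply_apply F E c v hJ (antidiagonal_over_eq_map F E n) Q hQ k' w]
  exact Subgroup.mul_mem _ (Subgroup.mul_mem _ (hQw w) (hk' w)) (Subgroup.inv_mem _ (hQw w))

/-! ## §5 The Iwasawa decomposition `H(F_v) = P_Δ(F_v) · H(𝒪_v)` at a good place -/

include hcδ hδ hd hT₀ hJD in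
/-- **LOCAL IWASAWA DECOMPOSITION FOR THE DOUBLED UNITARY GROUP.**  Let `v` be a finite place of `F` with `|2|_w = 1` and `T₀`, `T₀⁻¹`
integral at every `w ∣ v` (a good place; all but finitely many).  Then every `h ∈ H(F_v) = U(T₀ ⊕ −T₀)(F_v)` factors as `h = p · k` with
`p ∈ P_Δ(F_v)` (★ `IsSiegelDelta`) and `k ∈ H(𝒪_v)` (★ `UnitaryGroup.localInt`).  Transport of ★ `UnitaryGroup.exists_upper_mul_mem_localInt`
(`U(J_{2n})(F_v) = B · U(J_{2n})(𝒪_v)`, every finite `v`) along the rational frame `Q = e₂ ∘ (1 D; 1 −D)`, `D = ½ T₀⁻¹ W`.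
[cite: BruhatTits1972, (4.4.3)] [cite: Tits1979, §3.3.2] [cite: Casselman1980, §3] [cite: HarrisKudlaSweet1996, §1 (1.11)] -/
theorem exists_isSiegelDelta_mul_mem_localInt (hT₀d : IsUnit T₀.det)
    (h2 : ∀ w : PlacesOver E v, ValuativeRel.valuation (w.1.adicCompletion E) (2 : w.1.adicCompletion E) = 1)
    (hT : ∀ (w : PlacesOver E v) (i j : Fin n),
      ValuativeRel.valuation (w.1.adicCompletion E) (algebraMap E (w.1.adicCompletion E) (algebraMap F E (T₀ i j))) ≤ 1)
    (hTinv : ∀ (w : PlacesOver E v) (i j : Fin n),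
      ValuativeRel.valuation (w.1.adicCompletion E) (algebraMap E (w.1.adicCompletion E) (algebraMap F E (T₀⁻¹ i j))) ≤ 1)
    (h : UnitaryGroup.localPi E c (n + n) JD v) :
    ∃ p k : UnitaryGroup.localPi E c (n + n) JD v,
      IsSiegelDelta F E c hcδ hδ hd v n hT₀ hJD p ∧ k ∈ UnitaryGroup.localInt E c (n + n) JD v ∧ h = p * k := by
  classical
  -- the rational frame `Q`
  set D : Matrix (Fin n) (Fin n) F := (2 : F)⁻¹ • (T₀⁻¹ * (1 : Matrix (Fin n) (Fin n) F).submatrix id Fin.rev) with hD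
  set Qm : Matrix (Fin (n + n)) (Fin (n + n)) F := Matrix.reindex (e₂ n) (e₂ n) (Matrix.fromBlocks 1 D 1 (-D)) with hQm
  set Qi : Matrix (Fin (n + n)) (Fin (n + n)) F := Matrix.reindex (e₂ n) (e₂ n)
    (Matrix.fromBlocks ((2 : F)⁻¹ • (1 : Matrix (Fin n) (Fin n) F)) ((2 : F)⁻¹ • 1)
      ((1 : Matrix (Fin n) (Fin n) F).submatrix Fin.rev id * T₀) (-((1 : Matrix (Fin n) (Fin n) F).submatrix Fin.rev id * T₀))) with hQi
  have hmul : Qm * Qi = 1 := by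
    rw [hQm, hQi, reindex_mul_reindex, hD, frame_mul_frameInv hT₀d, Matrix.reindex_apply, Matrix.submatrix_one_equiv]
  have hmul' : Qi * Qm = 1 := by
    rw [hQm, hQi, reindex_mul_reindex, hD, frameInv_mul_frame hT₀d, Matrix.reindex_apply, Matrix.submatrix_one_equiv]
  let Q : GL (Fin (n + n)) F := ⟨Qm, Qi, hmul, hmul'⟩
  have hQval : (Q : Matrix (Fin (n + n)) (Fin (n + n)) F) = Matrix.reindex (e₂ n) (e₂ n) (Matrix.fromBlocks 1 D 1 (-D)) := rfl
  have hQinv : ((Q⁻¹ : GL (Fin (n + n)) F) : Matrix (Fin (n + n)) (Fin (n + n)) F) = Qi := rfl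
  have hQ : (Q : Matrix (Fin (n + n)) (Fin (n + n)) F)ᵀ * gramD F n T₀ * (Q : Matrix (Fin (n + n)) (Fin (n + n)) F) =
      (StdForm.antidiagonal (n + n)).over F := by
    rw [hQval, gramD, Matrix.transpose_reindex, reindex_mul_reindex, reindex_mul_reindex, hD, frame_transpose_mul_gram_mul_frame hT₀ hT₀d,
      reindex_antidiag_eq_antidiagonal_over]
  -- the Iwasawa decomposition of `Q⁻¹ h Q` in `U(J_{2n})(F_v)`
  set θ := FrameTransport.frameConj F E c v (n + n) hJD (antidiagonal_over_eq_map F E n) Q hQ with hθ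
  obtain ⟨b', k', hb', hk', hbk⟩ :=
    UnitaryGroup.exists_upper_mul_mem_localInt c (galConj_ne_one_of_delta F E c hcδ hδ) (θ.symm h)
  refine ⟨θ b', θ k', ?_, ?_, ?_⟩
  · exact isSiegelDelta_frameConj F E c hcδ hδ hd v n hT₀ hJD D Q hQval hQ b' hb'
  · refine frameConj_mem_localInt F E c v n hJD Q hQ (fun w => ?_) hk'
    exact frame_mem_glInt F E v n Q (by rw [hQval, hD]) (by rw [hQinv, hQi]) w (h2 w) (hT w) (hTinv w)
  · calc h = θ (θ.symm h) := (ContinuousMulEquiv.apply_symm_apply θ h).symm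
      _ = θ b' * θ k' := by rw [hbk, map_mul]

end Transport

end Summit.HodgeConjecture.HodgeConjecture.Cruxes.HLiu418.K2LiuLocalSiegelIwasawa

end
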